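import Summits.QuantumFields.BalabanUV.Beta.FP.KKTSecondVariation
import Summits.QuantumFields.BalabanUV.Beta.ConstrainedCriticalMap

/-!
# `BalabanUV.Beta.FP.OneShotKKTTorus` — road «FP» for binder row D1, row **GAMMA-0** of `LEAVES-FP.md` (owner d1-p3-g6, journal
# 2026-08-21T00:51Z): THE ONE SHOT IN KKT FORM ALONG A LINE OF BACKGROUNDS THROUGH THE CONSTRAINED MINIMISER — the second derivative of
# `W(s) := −½·log|det kkt(H_cov(U(c₀ + s•v)), Q_{U(c₀ + s•v)})|` is `KKTSecondVariation`'s SIX LOOPS with the CHAIN-RULE JETS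
# `Ḣ = DH_cov[U̇]`, `Q̇ = DQ[U̇]`, `Ḧ = D²H_cov[U̇,U̇] + DH_cov[Ü]`, `Q̈ = D²Q[U̇,U̇] + DQ[Ü]`, `U̇ = 𝓘v` (the minimiser's derivative), and the
# `Ü`-TADPOLE `−½tr(Γ·DH_cov[Ü]) − tr(𝓘·DQ[Ü])` DISPLAYED SEPARATELY (it is what the colour-parity symmetry S4 kills — here an explicit hypothesis)

HONEST DEPENDENCY (cell records, verbatim): «continuum YM on T⁴ ⇐ BetaPertH ∧ nine spine estimates (0/9 proved); BetaPertH ⇐ (D1) ∧ (D4) ∧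
CAP+tail; G-an2-4 gates asym, D1 and NE2/3/4.»  HONEST FRAMING (cell contract, verbatim): «discharging `BetaPertH` makes Bałaban's UV stability
UNCONDITIONAL — a real constructive-QFT result; it is NOT the continuum limit and NOT the Clay problem.»  THIS MODULE is [folklore] one-variable ∕
Fréchet calculus (Mathlib `HasDerivAt`, `HasFDerivAt`, `HasFDerivAt.comp_hasDerivAt`, `HasDerivAt.clm_apply`) composed with the tree's
`FP/KKTSecondVariation.hasDerivAt_oneShot_kkt` (row RHOA-10 ✓) BY NAME, over ABSTRACT data: a fine-field curve `γ : ℝ → (κ → ℝ)`, ABSTRACT `C²` maps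
`Hf : (κ → ℝ) → (ν → ν → ℝ)` («`H_cov`»), `Qf : (κ → ℝ) → (ρ → ν → ℝ)` («`Q_U`») with their Fréchet jets; the minimiser enters only through
an2's derivative statement `HasFDerivAt U (mulVecCLM (minOp Hc C)) c₀` (`Beta/ConstrainedCriticalMap.exists_criticalMap` ✓).  NO estimate, NO lattice
object, NO torus is constructed (every index type is an arbitrary `Fintype`: «on a finite torus every object is a finite matrix»), nothing of
Bałaban's manuscripts, no definition, no `def … : Prop`, nothing cited, 0 sorry.  It discharges NOTHING of `hbook`∕`hasym`∕D1.  NOT D1, NOT BetaPertH,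
NOT continuum, NOT Clay.

ABSOLUTE RULE (cell charter, verbatim): «No internally-minted statement may enter as a cited fact. Every hypothesis is either kernel-proved in this
package or a verbatim quotation of a PUBLISHED theorem with page reference. The manuscript(s) under audit are NOT citable for their own disputed
steps — they are the thing under adjudication; programme-internal (2001/route/tribunal) claims are never citable.»

THE ROW (owner, `LEAVES-FP.md` l.368, paraphrased to what is PROVED here).  «On a finite torus at level 0 the covariant-slice one shot
`W_n(V) := −½log|det kkt(H_cov(U_nV), Q_{U_nV})|` along `V = t·v` has `W_n″(0) =` the six loops of `KKTSecondVariation.sixLoops_kkt` with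
`H₁ = Ḣ_cov[𝓘v]` (chain rule through the minimiser; S4 kills `U_n″`), `Q₁ = Q̇[𝓘v]`, `H₂, Q₂` the second jets; legs (`flucCov`, `minOp`, `effForm`).»
WHAT IS PROVED (model level, all [folklore]):
* §1 CHAIN RULE for a matrix-valued map along a fine curve: first jet `u ↦ DHf(γ u)[γ̇ u]` near `t` (`hasDerivAt_comp_curve`), second jet at `t`
  `D²Hf[γ̇,γ̇] + DHf[γ̈]` (`hasDerivAt_jet₁_comp_curve`); symmetric values ⟹ symmetric first jet (`transpose_jet_of_symmetric`).
* §2 **`hasDerivAt_oneShot_comp_curve`** — `KKTSecondVariation.hasDerivAt_oneShot_kkt` for the composite curve `u ↦ (Hf (γ u), Qf (γ u))`: (i) near `t`,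
  `W′ = −½tr(Γ·DHf[γ̇]) − tr(𝓘·DQf[γ̇])`; (ii) at `t`, that first variation has derivative the SIX LOOPS with the chain-rule jets (second jets
  `D²Hf[γ̇,γ̇] + DHf[γ̈]`, `D²Qf[γ̇,γ̇] + DQf[γ̈]`);  **`hasDerivAt_oneShot_comp_curve_tadpole`** — the same value REGROUPED as
  (six loops with the PURE second jets `D²Hf[γ̇,γ̇]`, `D²Qf[γ̇,γ̇]`) `+` (the `γ̈`-TADPOLE `−½tr(Γ·DHf[γ̈]) − tr(𝓘·DQf[γ̈])`);
  **`hasDerivAt_oneShot_comp_curve_of_tadpole_eq_zero`** — under the DISPLAYED hypothesis that this tadpole vanishes (on the road: S4 colour parity at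
  the trivial background; NOT proved here, NOT a `def … : Prop` — an explicit equation among the binders) `W″(t)` is the six loops with pure jets.
* §3 THROUGH THE MINIMISER: `hasDerivAt_comp_line` (`s ↦ U(c₀ + s•v)` has derivative `DU(c₀)·v` at `0`) and **`hasDerivAt_criticalMap_line`**: with an2's
  `HasFDerivAt U (mulVecCLM (minOp Hc C)) c₀` the background line through the constrained minimiser has fine velocity `U̇ = minOp Hc C *ᵥ v = 𝓘v`
  («`H₁ = Ḣ_cov[𝓘v]`»); **`jet_eq_minOp_of_criticalMap_line`** — hence any first-jet curve `γ₁` of `s ↦ U(c₀ + s•v)` has `γ₁ 0 = 𝓘v`.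
NOT HERE (honest): the `ConstraintNormalisation` (GAMMA-7) and ghost addends of the row, the blocking to level `j` for the `(j,m)` family, the
identification of `Hf`, `Qf`, `U` with the road's torus objects (no torus is built here), S4 itself, any estimate.  0∕4 row-D1 binders touched.
Provenance: D1 formalisation swarm leaf seat `b2b-balaban-beta-d1-formalise-leaf-05` gen 11 (road «FP» row GAMMA-0, first refusal taken journal
2026-08-21T00:59Z), 2026-08-21.
-/

noncomputable section

namespace Summit.QuantumFields.BalabanUV.Beta.FP.OneShotKKTTorus

open Matrix Filter Topology
open Literature.MathematicalPhysics.QuantumFieldTheory.Balaban1983to89.Beta.Composition (kkt)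
open Literature.MathematicalPhysics.QuantumFieldTheory.Balaban1983to89.Beta.CompositionSingular (flucCov minOp effForm)
open Summit.QuantumFields.BalabanUV.Beta.D1BFx.SliceTransferModel (hasDerivAt_transpose)
open Summit.QuantumFields.BalabanUV.Beta.FP.KKTSecondVariation (hasDerivAt_oneShot_kkt)
open Summit.QuantumFields.BalabanUV.Beta.ConstrainedCriticalMap (mulVecCLM mulVecCLM_apply)

/-! ## §1 Chain rule for a matrix-valued map along a fine curve -/

section ChainRule

variable {E F : Type*} [NormedAddCommGroup E] [NormedSpace ℝ E] [NormedAddCommGroup F] [NormedSpace ℝ F]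

/-- [folklore] FIRST JET OF A COMPOSITE, NEAR `t`: if `γ` has the derivative curve `γ₁` near `t` and `Hf` has Fréchet derivative `dHf x` at every
`x` near `γ t`, then `u ↦ Hf (γ u)` has derivative `dHf (γ u) (γ₁ u)` at every `u` near `t`. -/
theorem hasDerivAt_comp_curve {γ : ℝ → E} {γ₁ : ℝ → E} {t : ℝ} {Hf : E → F} {dHf : E → (E →L[ℝ] F)}
    (hγ : ∀ᶠ u in 𝓝 t, HasDerivAt γ (γ₁ u) u) (hH : ∀ᶠ x in 𝓝 (γ t), HasFDerivAt Hf (dHf x) x) :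
    ∀ᶠ u in 𝓝 t, HasDerivAt (fun s => Hf (γ s)) (dHf (γ u) (γ₁ u)) u := by
  have hγc : ContinuousAt γ t := hγ.self_of_nhds.continuousAt
  filter_upwards [hγ, hγc.eventually hH] with u hu hHu
  exact hHu.comp_hasDerivAt u hu

/-- [folklore] SECOND JET OF A COMPOSITE, AT `t`: if moreover `γ₁` has derivative `w` at `t` and `dHf` has Fréchet derivative `d2Hf` at `γ t`, the
first-jet curve `u ↦ dHf (γ u) (γ₁ u)` has derivative `d2Hf (γ₁ t) (γ₁ t) + dHf (γ t) w` at `t` («`Ḧ = D²H[U̇,U̇] + DH[Ü]`»). -/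
theorem hasDerivAt_jet₁_comp_curve {γ : ℝ → E} {γ₁ : ℝ → E} {w : E} {t : ℝ} {dHf : E → (E →L[ℝ] F)} {d2Hf : E →L[ℝ] E →L[ℝ] F}
    (hγ : HasDerivAt γ (γ₁ t) t) (hγ₁ : HasDerivAt γ₁ w t) (hdH : HasFDerivAt dHf d2Hf (γ t)) :
    HasDerivAt (fun u => dHf (γ u) (γ₁ u)) (d2Hf (γ₁ t) (γ₁ t) + dHf (γ t) w) t := by
  have hc : HasDerivAt (fun u => dHf (γ u)) (d2Hf (γ₁ t)) t := hdH.comp_hasDerivAt t hγ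
  exact hc.clm_apply hγ₁

/-- [folklore] THE LINE OF BACKGROUNDS: `s ↦ U (c₀ + s • v)` has derivative `L v` at `0` when `U` has Fréchet derivative `L` at `c₀`. -/
theorem hasDerivAt_comp_line {U : E → F} {L : E →L[ℝ] F} {c₀ : E} (hU : HasFDerivAt U L c₀) (v : E) :
    HasDerivAt (fun s : ℝ => U (c₀ + s • v)) (L v) 0 := by
  have hline : HasDerivAt (fun s : ℝ => c₀ + s • v) ((1 : ℝ) • v) 0 := ((hasDerivAt_id (0 : ℝ)).smul_const v).const_add c₀
  rw [one_smul] at hline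
  have h0 : c₀ + (0 : ℝ) • v = c₀ := by rw [zero_smul, add_zero]
  have hU' : HasFDerivAt U L (c₀ + (0 : ℝ) • v) := by rw [h0]; exact hU
  exact hU'.comp_hasDerivAt (0 : ℝ) hline

end ChainRule

/-! ## §1b Symmetric values have symmetric jets -/

section Symmetric

variable {ν : Type*} [Fintype ν]

/-- [folklore] If the matrix curve `H` is symmetric near `t` and has derivative `H₁` at `t`, then `H₁` is symmetric. -/
theorem transpose_jet_of_symmetric {H : ℝ → ν → ν → ℝ} {H₁ : Matrix ν ν ℝ} {t : ℝ} (hH : HasDerivAt H (Matrix.of.symm H₁) t)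
    (hsym : ∀ᶠ u in 𝓝 t, (Matrix.of (H u))ᵀ = Matrix.of (H u)) : H₁ᵀ = H₁ := by
  have hT := hasDerivAt_transpose hH
  have heq : (fun u => Matrix.of.symm (Matrix.of (H u))ᵀ) =ᶠ[𝓝 t] H := by
    filter_upwards [hsym] with u hu
    rw [hu]; rfl
  have h2 : HasDerivAt H (Matrix.of.symm H₁ᵀ) t := hT.congr_of_eventuallyEq heq.symm
  have e : Matrix.of.symm H₁ = Matrix.of.symm H₁ᵀ := hH.unique h2
  have e' : H₁ = H₁ᵀ := e
  exact e'.symm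

end Symmetric

/-! ## §2 The one shot along a composite curve -/

section OneShot

variable {κ ν ρ : Type*} [Fintype κ] [Fintype ν] [Fintype ρ] [DecidableEq ν] [DecidableEq ρ]

/-- [folklore] **THE ONE SHOT IN KKT FORM ALONG A COMPOSITE CURVE** (`KKTSecondVariation.hasDerivAt_oneShot_kkt` ∘ chain rule).  Data: a fine
curve `γ` with first-jet curve `γ₁` near `t` and second jet `w` at `t`; matrix-valued maps `Hf` (symmetric near `γ t`), `Qf` with Fréchet jets `dHf`,
`dQf` near `γ t` and second jets `d2Hf`, `d2Qf` at `γ t`; Bałaban's bordered matrix `kkt (Hf (γ t)) (Qf (γ t))` non-degenerate.  Then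
(i) near `t`, `s ↦ −½·log|det kkt(Hf (γ s), Qf (γ s))|` has derivative `−½tr(Γ_u·DHf(γ u)[γ₁ u]) − tr(𝓘_u·DQf(γ u)[γ₁ u])`, and
(ii) this first variation has derivative at `t` the SIX LOOPS `½tr(ΓḢΓḢ) − ½tr(ΓḦ) + 2tr(ΓḢ𝓘Q̇) + tr(𝓘Q̇𝓘Q̇) − tr(𝔊·Q̇ΓQ̇ᵀ) − tr(𝓘Q̈)` with the
CHAIN-RULE JETS `Ḣ = DHf[γ₁ t]`, `Q̇ = DQf[γ₁ t]`, `Ḧ = D²Hf[γ₁ t, γ₁ t] + DHf[w]`, `Q̈ = D²Qf[γ₁ t, γ₁ t] + DQf[w]` (legs of `(kkt (Hf (γ t)) (Qf (γ t)))⁻¹`). -/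
theorem hasDerivAt_oneShot_comp_curve {γ γ₁ : ℝ → κ → ℝ} {w : κ → ℝ} {t : ℝ}
    {Hf : (κ → ℝ) → ν → ν → ℝ} {dHf : (κ → ℝ) → ((κ → ℝ) →L[ℝ] (ν → ν → ℝ))} {d2Hf : (κ → ℝ) →L[ℝ] (κ → ℝ) →L[ℝ] (ν → ν → ℝ)}
    {Qf : (κ → ℝ) → ρ → ν → ℝ} {dQf : (κ → ℝ) → ((κ → ℝ) →L[ℝ] (ρ → ν → ℝ))} {d2Qf : (κ → ℝ) →L[ℝ] (κ → ℝ) →L[ℝ] (ρ → ν → ℝ)}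
    (hγ : ∀ᶠ u in 𝓝 t, HasDerivAt γ (γ₁ u) u) (hγ₁ : HasDerivAt γ₁ w t)
    (hH : ∀ᶠ x in 𝓝 (γ t), HasFDerivAt Hf (dHf x) x) (hdH : HasFDerivAt dHf d2Hf (γ t))
    (hQ : ∀ᶠ x in 𝓝 (γ t), HasFDerivAt Qf (dQf x) x) (hdQ : HasFDerivAt dQf d2Qf (γ t))
    (hsym : ∀ᶠ x in 𝓝 (γ t), (Matrix.of (Hf x))ᵀ = Matrix.of (Hf x))
    (hdet : (kkt (Matrix.of (Hf (γ t))) (Matrix.of (Qf (γ t)))).det ≠ 0) :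
    (∀ᶠ u in 𝓝 t, HasDerivAt (fun s => -(1 / 2 : ℝ) * Real.log |(kkt (Matrix.of (Hf (γ s))) (Matrix.of (Qf (γ s)))).det|)
        (-(1 / 2 : ℝ) * (flucCov (Matrix.of (Hf (γ u))) (Matrix.of (Qf (γ u))) * Matrix.of (dHf (γ u) (γ₁ u))).trace
          - (minOp (Matrix.of (Hf (γ u))) (Matrix.of (Qf (γ u))) * Matrix.of (dQf (γ u) (γ₁ u))).trace) u)
    ∧ HasDerivAt (fun u => -(1 / 2 : ℝ) * (flucCov (Matrix.of (Hf (γ u))) (Matrix.of (Qf (γ u))) * Matrix.of (dHf (γ u) (γ₁ u))).trace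
          - (minOp (Matrix.of (Hf (γ u))) (Matrix.of (Qf (γ u))) * Matrix.of (dQf (γ u) (γ₁ u))).trace)
      ((1 / 2 : ℝ) * (flucCov (Matrix.of (Hf (γ t))) (Matrix.of (Qf (γ t))) * Matrix.of (dHf (γ t) (γ₁ t)) * (flucCov (Matrix.of (Hf (γ t))) (Matrix.of (Qf (γ t))) * Matrix.of (dHf (γ t) (γ₁ t)))).trace
        - (1 / 2 : ℝ) * (flucCov (Matrix.of (Hf (γ t))) (Matrix.of (Qf (γ t))) * Matrix.of (d2Hf (γ₁ t) (γ₁ t) + dHf (γ t) w)).trace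
        + 2 * (flucCov (Matrix.of (Hf (γ t))) (Matrix.of (Qf (γ t))) * Matrix.of (dHf (γ t) (γ₁ t)) * (minOp (Matrix.of (Hf (γ t))) (Matrix.of (Qf (γ t))) * Matrix.of (dQf (γ t) (γ₁ t)))).trace
        + (minOp (Matrix.of (Hf (γ t))) (Matrix.of (Qf (γ t))) * Matrix.of (dQf (γ t) (γ₁ t)) * (minOp (Matrix.of (Hf (γ t))) (Matrix.of (Qf (γ t))) * Matrix.of (dQf (γ t) (γ₁ t)))).trace
        - (effForm (Matrix.of (Hf (γ t))) (Matrix.of (Qf (γ t))) * (Matrix.of (dQf (γ t) (γ₁ t)) * (flucCov (Matrix.of (Hf (γ t))) (Matrix.of (Qf (γ t))) * (Matrix.of (dQf (γ t) (γ₁ t)))ᵀ))).trace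
        - (minOp (Matrix.of (Hf (γ t))) (Matrix.of (Qf (γ t))) * Matrix.of (d2Qf (γ₁ t) (γ₁ t) + dQf (γ t) w)).trace) t := by
  -- the composite curves and their jets, in the binders of `hasDerivAt_oneShot_kkt`
  have hHc : ∀ᶠ u in 𝓝 t, HasDerivAt (fun s => Hf (γ s)) (dHf (γ u) (γ₁ u)) u := hasDerivAt_comp_curve hγ hH
  have hQc : ∀ᶠ u in 𝓝 t, HasDerivAt (fun s => Qf (γ s)) (dQf (γ u) (γ₁ u)) u := hasDerivAt_comp_curve hγ hQ
  have hH₁c : HasDerivAt (fun u => dHf (γ u) (γ₁ u)) (Matrix.of.symm (Matrix.of (d2Hf (γ₁ t) (γ₁ t) + dHf (γ t) w))) t :=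
    hasDerivAt_jet₁_comp_curve hγ.self_of_nhds hγ₁ hdH
  have hQ₁c : HasDerivAt (fun u => dQf (γ u) (γ₁ u)) (Matrix.of.symm (Matrix.of (d2Qf (γ₁ t) (γ₁ t) + dQf (γ t) w))) t :=
    hasDerivAt_jet₁_comp_curve hγ.self_of_nhds hγ₁ hdQ
  -- symmetry of the composite near `t` and of its first jet at `t`
  have hγc : ContinuousAt γ t := hγ.self_of_nhds.continuousAt
  have hsymc : ∀ᶠ u in 𝓝 t, (Matrix.of (Hf (γ u)))ᵀ = Matrix.of (Hf (γ u)) := hγc.eventually hsym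
  have hsym₁ : (Matrix.of (dHf (γ t) (γ₁ t)))ᵀ = Matrix.of (dHf (γ t) (γ₁ t)) :=
    transpose_jet_of_symmetric (H := fun s => Hf (γ s)) hHc.self_of_nhds hsymc
  exact hasDerivAt_oneShot_kkt (H := fun s => Hf (γ s)) (H₁ := fun u => dHf (γ u) (γ₁ u)) (Q := fun s => Qf (γ s))
    (Q₁ := fun u => dQf (γ u) (γ₁ u)) hHc hH₁c hQc hQ₁c hsymc hsym₁ hdet

/-- [folklore] **THE `γ̈`-TADPOLE DISPLAYED.**  The same second variation, regrouped: (six loops with the PURE second jets `D²Hf[γ₁ t, γ₁ t]`,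
`D²Qf[γ₁ t, γ₁ t]`) `+` (the tadpole of the fine acceleration `w = γ̈(t)`: `−½tr(Γ·DHf[w]) − tr(𝓘·DQf[w])` — the first variation of the one shot
in the fine direction `w`).  On the road this tadpole is what the colour-parity symmetry S4 kills at the trivial background («S4 kills `U_n″`»). -/
theorem hasDerivAt_oneShot_comp_curve_tadpole {γ γ₁ : ℝ → κ → ℝ} {w : κ → ℝ} {t : ℝ}
    {Hf : (κ → ℝ) → ν → ν → ℝ} {dHf : (κ → ℝ) → ((κ → ℝ) →L[ℝ] (ν → ν → ℝ))} {d2Hf : (κ → ℝ) →L[ℝ] (κ → ℝ) →L[ℝ] (ν → ν → ℝ)}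
    {Qf : (κ → ℝ) → ρ → ν → ℝ} {dQf : (κ → ℝ) → ((κ → ℝ) →L[ℝ] (ρ → ν → ℝ))} {d2Qf : (κ → ℝ) →L[ℝ] (κ → ℝ) →L[ℝ] (ρ → ν → ℝ)}
    (hγ : ∀ᶠ u in 𝓝 t, HasDerivAt γ (γ₁ u) u) (hγ₁ : HasDerivAt γ₁ w t)
    (hH : ∀ᶠ x in 𝓝 (γ t), HasFDerivAt Hf (dHf x) x) (hdH : HasFDerivAt dHf d2Hf (γ t))
    (hQ : ∀ᶠ x in 𝓝 (γ t), HasFDerivAt Qf (dQf x) x) (hdQ : HasFDerivAt dQf d2Qf (γ t))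
    (hsym : ∀ᶠ x in 𝓝 (γ t), (Matrix.of (Hf x))ᵀ = Matrix.of (Hf x))
    (hdet : (kkt (Matrix.of (Hf (γ t))) (Matrix.of (Qf (γ t)))).det ≠ 0) :
    HasDerivAt (fun u => -(1 / 2 : ℝ) * (flucCov (Matrix.of (Hf (γ u))) (Matrix.of (Qf (γ u))) * Matrix.of (dHf (γ u) (γ₁ u))).trace
          - (minOp (Matrix.of (Hf (γ u))) (Matrix.of (Qf (γ u))) * Matrix.of (dQf (γ u) (γ₁ u))).trace)
      ((1 / 2 : ℝ) * (flucCov (Matrix.of (Hf (γ t))) (Matrix.of (Qf (γ t))) * Matrix.of (dHf (γ t) (γ₁ t)) * (flucCov (Matrix.of (Hf (γ t))) (Matrix.of (Qf (γ t))) * Matrix.of (dHf (γ t) (γ₁ t)))).trace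
        - (1 / 2 : ℝ) * (flucCov (Matrix.of (Hf (γ t))) (Matrix.of (Qf (γ t))) * Matrix.of (d2Hf (γ₁ t) (γ₁ t))).trace
        + 2 * (flucCov (Matrix.of (Hf (γ t))) (Matrix.of (Qf (γ t))) * Matrix.of (dHf (γ t) (γ₁ t)) * (minOp (Matrix.of (Hf (γ t))) (Matrix.of (Qf (γ t))) * Matrix.of (dQf (γ t) (γ₁ t)))).trace
        + (minOp (Matrix.of (Hf (γ t))) (Matrix.of (Qf (γ t))) * Matrix.of (dQf (γ t) (γ₁ t)) * (minOp (Matrix.of (Hf (γ t))) (Matrix.of (Qf (γ t))) * Matrix.of (dQf (γ t) (γ₁ t)))).trace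
        - (effForm (Matrix.of (Hf (γ t))) (Matrix.of (Qf (γ t))) * (Matrix.of (dQf (γ t) (γ₁ t)) * (flucCov (Matrix.of (Hf (γ t))) (Matrix.of (Qf (γ t))) * (Matrix.of (dQf (γ t) (γ₁ t)))ᵀ))).trace
        - (minOp (Matrix.of (Hf (γ t))) (Matrix.of (Qf (γ t))) * Matrix.of (d2Qf (γ₁ t) (γ₁ t))).trace
        + (-(1 / 2 : ℝ) * (flucCov (Matrix.of (Hf (γ t))) (Matrix.of (Qf (γ t))) * Matrix.of (dHf (γ t) w)).trace - (minOp (Matrix.of (Hf (γ t))) (Matrix.of (Qf (γ t))) * Matrix.of (dQf (γ t) w)).trace)) t := by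
  refine (hasDerivAt_oneShot_comp_curve hγ hγ₁ hH hdH hQ hdQ hsym hdet).2.congr_deriv ?_
  rw [← Matrix.of_add_of, ← Matrix.of_add_of, Matrix.mul_add, Matrix.mul_add, Matrix.trace_add, Matrix.trace_add]
  ring

/-- [folklore] **THE ROW'S DISPLAY UNDER THE S4 HYPOTHESIS.**  If the `γ̈`-tadpole vanishes — `−½tr(Γ·DHf(γ t)[w]) − tr(𝓘·DQf(γ t)[w]) = 0`, an
explicit equation among the binders (on the road: colour parity S4 at the trivial background; NOT proved here) — then the second variation of the one
shot at `t` is EXACTLY `KKTSecondVariation`'s six loops with the chain-rule jets `Ḣ = DHf[γ̇]`, `Q̇ = DQf[γ̇]`, `Ḧ = D²Hf[γ̇,γ̇]`, `Q̈ = D²Qf[γ̇,γ̇]`. -/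
theorem hasDerivAt_oneShot_comp_curve_of_tadpole_eq_zero {γ γ₁ : ℝ → κ → ℝ} {w : κ → ℝ} {t : ℝ}
    {Hf : (κ → ℝ) → ν → ν → ℝ} {dHf : (κ → ℝ) → ((κ → ℝ) →L[ℝ] (ν → ν → ℝ))} {d2Hf : (κ → ℝ) →L[ℝ] (κ → ℝ) →L[ℝ] (ν → ν → ℝ)}
    {Qf : (κ → ℝ) → ρ → ν → ℝ} {dQf : (κ → ℝ) → ((κ → ℝ) →L[ℝ] (ρ → ν → ℝ))} {d2Qf : (κ → ℝ) →L[ℝ] (κ → ℝ) →L[ℝ] (ρ → ν → ℝ)}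
    (hγ : ∀ᶠ u in 𝓝 t, HasDerivAt γ (γ₁ u) u) (hγ₁ : HasDerivAt γ₁ w t)
    (hH : ∀ᶠ x in 𝓝 (γ t), HasFDerivAt Hf (dHf x) x) (hdH : HasFDerivAt dHf d2Hf (γ t))
    (hQ : ∀ᶠ x in 𝓝 (γ t), HasFDerivAt Qf (dQf x) x) (hdQ : HasFDerivAt dQf d2Qf (γ t))
    (hsym : ∀ᶠ x in 𝓝 (γ t), (Matrix.of (Hf x))ᵀ = Matrix.of (Hf x))
    (hdet : (kkt (Matrix.of (Hf (γ t))) (Matrix.of (Qf (γ t)))).det ≠ 0)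
    (htad : (-(1 / 2 : ℝ) * (flucCov (Matrix.of (Hf (γ t))) (Matrix.of (Qf (γ t))) * Matrix.of (dHf (γ t) w)).trace - (minOp (Matrix.of (Hf (γ t))) (Matrix.of (Qf (γ t))) * Matrix.of (dQf (γ t) w)).trace) = 0) :
    HasDerivAt (fun u => -(1 / 2 : ℝ) * (flucCov (Matrix.of (Hf (γ u))) (Matrix.of (Qf (γ u))) * Matrix.of (dHf (γ u) (γ₁ u))).trace
          - (minOp (Matrix.of (Hf (γ u))) (Matrix.of (Qf (γ u))) * Matrix.of (dQf (γ u) (γ₁ u))).trace)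
      ((1 / 2 : ℝ) * (flucCov (Matrix.of (Hf (γ t))) (Matrix.of (Qf (γ t))) * Matrix.of (dHf (γ t) (γ₁ t)) * (flucCov (Matrix.of (Hf (γ t))) (Matrix.of (Qf (γ t))) * Matrix.of (dHf (γ t) (γ₁ t)))).trace
        - (1 / 2 : ℝ) * (flucCov (Matrix.of (Hf (γ t))) (Matrix.of (Qf (γ t))) * Matrix.of (d2Hf (γ₁ t) (γ₁ t))).trace
        + 2 * (flucCov (Matrix.of (Hf (γ t))) (Matrix.of (Qf (γ t))) * Matrix.of (dHf (γ t) (γ₁ t)) * (minOp (Matrix.of (Hf (γ t))) (Matrix.of (Qf (γ t))) * Matrix.of (dQf (γ t) (γ₁ t)))).trace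
        + (minOp (Matrix.of (Hf (γ t))) (Matrix.of (Qf (γ t))) * Matrix.of (dQf (γ t) (γ₁ t)) * (minOp (Matrix.of (Hf (γ t))) (Matrix.of (Qf (γ t))) * Matrix.of (dQf (γ t) (γ₁ t)))).trace
        - (effForm (Matrix.of (Hf (γ t))) (Matrix.of (Qf (γ t))) * (Matrix.of (dQf (γ t) (γ₁ t)) * (flucCov (Matrix.of (Hf (γ t))) (Matrix.of (Qf (γ t))) * (Matrix.of (dQf (γ t) (γ₁ t)))ᵀ))).trace
        - (minOp (Matrix.of (Hf (γ t))) (Matrix.of (Qf (γ t))) * Matrix.of (d2Qf (γ₁ t) (γ₁ t))).trace) t := by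
  refine (hasDerivAt_oneShot_comp_curve_tadpole hγ hγ₁ hH hdH hQ hdQ hsym hdet).congr_deriv ?_
  rw [htad, add_zero]

end OneShot

/-! ## §3 Through the constrained minimiser: `U̇ = 𝓘v` -/

section Minimiser

variable {κ μ : Type*} [Fintype κ] [Fintype μ] [DecidableEq κ] [DecidableEq μ]

/-- [folklore] **THE BACKGROUND LINE THROUGH THE MINIMISER HAS FINE VELOCITY `𝓘v`.**  With an2's derivative of the constrained critical map,
`HasFDerivAt U (mulVecCLM (minOp Hc C)) c₀` (`Beta/ConstrainedCriticalMap.exists_criticalMap`), the fine curve `s ↦ U (c₀ + s • v)` has derivative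
`minOp Hc C *ᵥ v` at `s = 0` — the «`U̇ = 𝓘v`» of the row («`H₁ = Ḣ_cov[𝓘v]`» is then §2 with `γ₁ 0 = 𝓘v`). -/
theorem hasDerivAt_criticalMap_line {U : (μ → ℝ) → (κ → ℝ)} {Hc : Matrix κ κ ℝ} {C : Matrix μ κ ℝ} {c₀ : μ → ℝ}
    (hU : HasFDerivAt U (mulVecCLM (minOp Hc C)) c₀) (v : μ → ℝ) :
    HasDerivAt (fun s : ℝ => U (c₀ + s • v)) (minOp Hc C *ᵥ v) 0 := by
  have h := hasDerivAt_comp_line hU v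
  rw [mulVecCLM_apply] at h
  exact h

/-- [folklore] Consequently ANY first-jet curve `γ₁` of the background line through the minimiser starts at `γ₁ 0 = minOp Hc C *ᵥ v` (uniqueness of
derivatives) — the substitution that turns §2's jets `DHf(U c₀)[γ₁ 0]`, `DQf(U c₀)[γ₁ 0]` into the row's `Ḣ_cov[𝓘v]`, `Q̇[𝓘v]`. -/
theorem jet_eq_minOp_of_criticalMap_line {U : (μ → ℝ) → (κ → ℝ)} {Hc : Matrix κ κ ℝ} {C : Matrix μ κ ℝ} {c₀ v : μ → ℝ} {γ₁ : ℝ → κ → ℝ}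
    (hU : HasFDerivAt U (mulVecCLM (minOp Hc C)) c₀) (hγ : ∀ᶠ s in 𝓝 (0 : ℝ), HasDerivAt (fun s : ℝ => U (c₀ + s • v)) (γ₁ s) s) :
    γ₁ 0 = minOp Hc C *ᵥ v :=
  hγ.self_of_nhds.unique (hasDerivAt_criticalMap_line hU v)

end Minimiser

end Summit.QuantumFields.BalabanUV.Beta.FP.OneShotKKTTorus

end
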